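import Summits.RiemannHypothesis.RiemannHypothesis.Theorems.Splittings.RobinFiniteDensityTwoLayer
import Summits.RiemannHypothesis.RiemannHypothesis.Theorems.Splittings.RobinFiniteLowHeightRanges
import HarnessLib

/-!
# RobinFiniteKernelPsiTheta — PRINT-FREE pointwise bounds for `ψ − θ` from the KERNEL tables, and Nicolas's `J − K` integral with the kernel
# truncation (SPLIT-robin-finite gen 15 «THE KERNEL HEIGHT PAYS», part 1/4; tree imports only)

Cell rh-split, card `cards/SPLIT-robin-finite.md` §22.  HONEST LABEL: «SPLITTING SEARCH over kernel-typed RH-EQUIVALENCES; a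
splitting A ∧ B ⟹ RH is CONDITIONAL bookkeeping unless A and B are both proved; nothing here bears on the truth of RH.»

In the tree's `c = 1` core (`RobinFiniteC1Core.corePwLower1_of_stubs`) the two RH-free PRINT facts {Büthe 2018 Thm 2, BKLNW 2021 §1.2} enter at
exactly ONE place: stub S4, `ψ(t) − θ(t) ≤ 1.021√t + (4/3)t^{1/3}` on ALL of `[x, ∞)`, integrated against Nicolas's weight `w₀ ≍ 2 log t/t²`.
This file replaces S4 by three PRINT-FREE regimes — `t < 2³²`: the kernel theorem `psi_sub_theta_le_of_lt_two_pow_32` (`ψ − θ ≤ √t + (4/3)t^{1/3}`);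
`2³² ≤ t ≤ 7.8·10¹³`: Nicolas's identity `ψ − θ = θ(√t) + θ(t^{1/3}) + Σ_{k≥4} θ(t^{1/k})` (`NicolasPsiTheta.psi_sub_theta_eq`) with
`θ(√t) ≤ 1.0192√t`, `θ(t^{1/3}) ≤ 1.0666·t^{1/3}` from the KERNEL table `abs_theta_sub_le_smallRange` (`δ = log²/(8π√·)` antitone from `599`:
`δ(65536) ≤ 0.01912`, `δ(599) ≤ 0.0666`) and `Σ_{k≥4} ≤ log 4 · 0.3289 · t^{1/3}` (Chebyshev, Mathlib `Chebyshev.theta_le_log4_mul_x`; tree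
`sum_rpow_sub_third_le_32`); `t ≥ 2³²` anywhere: Chebyshev's `log 4` on every root (`1.3863√t + 1.8423 t^{1/3}`) — and splits Nicolas's
`∫_x^X (ψ − θ) w₀` at `4.2·10⁹ < 2³²` and `7.8·10¹³ < 8 886 113²`: the excess over the engine's `1.021 F_{1/2}(x) + (4/3) F_{1/3}(x)` is the ABSOLUTE
constant `0.51·F_{1/3}(4.2·10⁹) + 0.3663·F_{1/2}(7.8·10¹³) ≤ 0.51·2.63·10⁻⁸ + 0.3663·7.4·10⁻⁹ ≤ 1.62·10⁻⁸` (`jk_partial_le_kernel`).  Standard axioms;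
0 `def`, 0 `sorry`, no named fact, no RH.  Nothing here bears on the truth of RH.
-/

set_option linter.dupNamespace false

noncomputable section

open Real Filter Finset
open scoped Chebyshev ComplexConjugate

namespace Summit.RiemannHypothesis.RiemannHypothesis.Theorems.Splittings.RobinFiniteC1

open Literature.NumberTheory.LFunctions Literature.NumberTheory.DiophantineGeometry
open RobinAnalyticSharp RobinAnalyticSharp.Cells
open NicolasJ NicolasFz NicolasK NicolasJExplicit
open Summit.RiemannHypothesis.RiemannHypothesis.Theorems.Splittings.RobinFiniteE3
open Summit.RiemannHypothesis.RiemannHypothesis.Theorems.Splittings.RobinFiniteTail (zeroTailBound_tailH tailH_nonneg tailH_1e5_le)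
open Summit.RiemannHypothesis.RiemannHypothesis.Theorems.Splittings.RobinFiniteE1c

section KernelPsiTheta

open MeasureTheory


/-! ### F1 · print-free pointwise bounds for `ψ − θ` (kernel `ψ−θ` theorem below `2³²`, kernel `θ`-table, Chebyshev's `log 4`) -/

/-- `log 4 ≤ 1.3863` (private copy: the identical public statement is the landed
`Literature.NumberTheory.Sieve.SmoothSaddlePointApprox.log_four_le`, not imported here). -/
private theorem log_four_le : Real.log 4 ≤ 1.3863 := by
  rw [show (4 : ℝ) = 2 ^ 2 by norm_num, Real.log_pow]
  have := Real.log_two_lt_d9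
  push_cast
  linarith

/-- Chebyshev (Mathlib `theta_le_log4_mul_x`): `θ(y) ≤ 1.3863·y` for every `y ≥ 0` — elementary, print-free. -/
theorem theta_le_log4 {y : ℝ} (hy : 0 ≤ y) : θ y ≤ 1.3863 * y :=
  (Chebyshev.theta_le_log4_mul_x hy).trans (mul_le_mul_of_nonneg_right log_four_le hy)

/-- KERNEL table, crude form: `θ(y) ≤ 1.0666·y` for `599 ≤ y ≤ 8 886 113` (`abs_theta_sub_le_smallRange`, `δ(y) ≤ δ(599) ≤ 0.0666`). -/
theorem theta_le_of_kernelTable {y : ℝ} (hy : 599 ≤ y) (hy' : y ≤ 8886113) : θ y ≤ 1.0666 * y := by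
  have hy0 : 0 < y := by linarith
  have h1 := (abs_le.1 (abs_theta_sub_le_smallRange hy hy')).2
  have hδ := schoenfeldDelta_le hy
  rw [schoenfeldDelta] at hδ
  have hsy : 0 < √y := Real.sqrt_pos.2 hy0
  have h2 : Real.log y ^ 2 ≤ 0.0666 * (8 * π * √y) := (div_le_iff₀ (by positivity)).1 hδ
  have hkey : √y * Real.log y ^ 2 / (8 * π) ≤ 0.0666 * y := by
    rw [div_le_iff₀ (by positivity)]
    have hy'' : √y * √y = y := Real.mul_self_sqrt hy0.le
    calc √y * Real.log y ^ 2 ≤ √y * (0.0666 * (8 * π * √y)) := mul_le_mul_of_nonneg_left h2 hsy.le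
      _ = 0.0666 * (√y * √y) * (8 * π) := by ring
      _ = 0.0666 * y * (8 * π) := by rw [hy'']
  linarith

/-- `δ(65536) = log²(2¹⁶)/(8π·256) ≤ 0.01912`. -/
theorem schoenfeldDelta_65536_le : schoenfeldDelta 65536 ≤ 0.01912 := by
  unfold schoenfeldDelta
  have hs : √(65536 : ℝ) = 256 := by
    rw [show (65536 : ℝ) = 256 ^ 2 by norm_num, Real.sqrt_sq (by norm_num)]
  have hlog : Real.log 65536 ≤ 11.0903549 := by
    rw [show (65536 : ℝ) = 2 ^ 16 by norm_num, Real.log_pow]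
    have := Real.log_two_lt_d9
    push_cast
    linarith
  have hlog0 : 0 ≤ Real.log 65536 := Real.log_nonneg (by norm_num)
  have hπ := Real.pi_gt_d6
  rw [hs, div_le_iff₀ (by positivity)]
  have h2 : Real.log 65536 ^ 2 ≤ 11.0903549 ^ 2 := pow_le_pow_left₀ hlog0 hlog 2
  nlinarith

/-- KERNEL table, square-root range: `θ(y) ≤ 1.0192·y` for `65536 ≤ y ≤ 8 886 113` (`δ` antitone from `599`: `δ(y) ≤ δ(65536) ≤ 0.01912`). -/
theorem theta_le_of_kernelTable' {y : ℝ} (hy : 65536 ≤ y) (hy' : y ≤ 8886113) : θ y ≤ 1.0192 * y := by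
  have hy0 : 0 < y := by linarith
  have h1 := (abs_le.1 (abs_theta_sub_le_smallRange (by linarith) hy')).2
  have hδ := (schoenfeldDelta_antitone (by norm_num) hy).trans schoenfeldDelta_65536_le
  rw [schoenfeldDelta] at hδ
  have hsy : 0 < √y := Real.sqrt_pos.2 hy0
  have h2 : Real.log y ^ 2 ≤ 0.01912 * (8 * π * √y) := (div_le_iff₀ (by positivity)).1 hδ
  have hkey : √y * Real.log y ^ 2 / (8 * π) ≤ 0.01912 * y := by
    rw [div_le_iff₀ (by positivity)]
    have hy'' : √y * √y = y := Real.mul_self_sqrt hy0.le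
    calc √y * Real.log y ^ 2 ≤ √y * (0.01912 * (8 * π * √y)) := mul_le_mul_of_nonneg_left h2 hsy.le
      _ = 0.01912 * (√y * √y) * (8 * π) := by ring
      _ = 0.01912 * y * (8 * π) := by rw [hy'']
  linarith

/-- The higher roots, print-free: `Σ_{4 ≤ k ≤ log₂ t} θ(t^{1/k}) ≤ 0.456·t^{1/3}` for `t ≥ 2³²`
(Chebyshev's `log 4` and the tree's `Σ_{k≥4} t^{1/k − 1/3} ≤ 0.3289`). -/
theorem sum_theta_roots_le {t : ℝ} (ht : (2 : ℝ) ^ 32 ≤ t) :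
    ∑ k ∈ Finset.Icc 4 ⌊Real.log t / Real.log 2⌋₊, θ (t ^ ((1 : ℝ) / k)) ≤ 0.456 * t ^ ((1 : ℝ) / 3) := by
  have ht0 : 0 < t := lt_of_lt_of_le (by norm_num) ht
  have hS := NicolasPsiTheta.sum_rpow_sub_third_le_32 ht
  have h3 : 0 ≤ t ^ ((1 : ℝ) / 3) := by positivity
  calc ∑ k ∈ Finset.Icc 4 ⌊Real.log t / Real.log 2⌋₊, θ (t ^ ((1 : ℝ) / k))
      ≤ ∑ k ∈ Finset.Icc 4 ⌊Real.log t / Real.log 2⌋₊, 1.3863 * t ^ ((1 : ℝ) / k) :=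
        Finset.sum_le_sum fun k _ ↦ theta_le_log4 (by positivity)
    _ = 1.3863 * (t ^ ((1 : ℝ) / 3) *
          ∑ k ∈ Finset.Icc 4 ⌊Real.log t / Real.log 2⌋₊, t ^ ((1 : ℝ) / k - 1 / 3)) := by
        rw [← Finset.mul_sum, NicolasPsiTheta.sum_rpow_eq_mul ht0]
    _ ≤ 1.3863 * (t ^ ((1 : ℝ) / 3) * 0.3289) := by gcongr
    _ ≤ 0.456 * t ^ ((1 : ℝ) / 3) := by nlinarith

/-- **Regime (ii), print-free**: `ψ(t) − θ(t) ≤ 1.0192√t + 1.5226·t^{1/3}` for `2³² ≤ t ≤ 7.8·10¹³` (Nicolas's identity; `θ(√t)`,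
`θ(t^{1/3})` by the KERNEL table — `65536 ≤ √t ≤ 8 886 113`, `599 ≤ t^{1/3} ≤ 8 886 113` — and the higher roots by Chebyshev). -/
theorem psi_sub_theta_le_mid {t : ℝ} (ht : (2 : ℝ) ^ 32 ≤ t) (ht' : t ≤ 7.8e13) :
    ψ t - θ t ≤ 1.0192 * Real.sqrt t + 1.5226 * t ^ ((1 : ℝ) / 3) := by
  have ht0 : 0 < t := lt_of_lt_of_le (by norm_num) ht
  have h16 : (2 : ℝ) ^ 4 ≤ t := le_trans (by norm_num) ht
  rw [NicolasPsiTheta.psi_sub_theta_eq h16, Real.sqrt_eq_rpow]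
  have h2lo : (65536 : ℝ) ≤ t ^ (1 / 2 : ℝ) := by
    rw [← Real.sqrt_eq_rpow, show (65536 : ℝ) = √((2 : ℝ) ^ 32) by
      rw [show (2 : ℝ) ^ 32 = 65536 ^ 2 by norm_num, Real.sqrt_sq (by norm_num)]]
    exact Real.sqrt_le_sqrt ht
  have h2hi : t ^ (1 / 2 : ℝ) ≤ 8886113 := by
    rw [← Real.sqrt_eq_rpow, Real.sqrt_le_left (by norm_num)]
    exact ht'.trans (by norm_num)
  have h3lo : (599 : ℝ) ≤ t ^ ((1 : ℝ) / 3) := by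
    have e : (599 : ℝ) = ((599 : ℝ) ^ (3 : ℕ)) ^ ((1 : ℝ) / 3) := by
      rw [← Real.rpow_natCast, ← Real.rpow_mul (by norm_num)]; norm_num
    have h : (599 : ℝ) ^ (3 : ℕ) ≤ t := le_trans (by norm_num) ht
    rw [e]
    exact Real.rpow_le_rpow (by norm_num) h (by norm_num)
  have h3hi : t ^ ((1 : ℝ) / 3) ≤ 8886113 := by
    have e : (8886113 : ℝ) = ((8886113 : ℝ) ^ (3 : ℕ)) ^ ((1 : ℝ) / 3) := by
      rw [← Real.rpow_natCast, ← Real.rpow_mul (by norm_num)]; norm_num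
    have h : t ≤ (8886113 : ℝ) ^ (3 : ℕ) := ht'.trans (by norm_num)
    rw [e]
    exact Real.rpow_le_rpow ht0.le h (by norm_num)
  have hθ2 := theta_le_of_kernelTable' h2lo h2hi
  have hθ3 := theta_le_of_kernelTable h3lo h3hi
  have hsum4 := sum_theta_roots_le ht
  linarith

/-- **Regime (iii), print-free**: `ψ(t) − θ(t) ≤ 1.3863√t + 1.8423·t^{1/3}` for every `t ≥ 2³²` (Chebyshev's `log 4` on all roots). -/
theorem psi_sub_theta_le_far {t : ℝ} (ht : (2 : ℝ) ^ 32 ≤ t) :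
    ψ t - θ t ≤ 1.3863 * Real.sqrt t + 1.8423 * t ^ ((1 : ℝ) / 3) := by
  have ht0 : 0 < t := lt_of_lt_of_le (by norm_num) ht
  have h16 : (2 : ℝ) ^ 4 ≤ t := le_trans (by norm_num) ht
  rw [NicolasPsiTheta.psi_sub_theta_eq h16, Real.sqrt_eq_rpow]
  have hθ2 := theta_le_log4 (y := t ^ (1 / 2 : ℝ)) (by positivity)
  have hθ3 := theta_le_log4 (y := t ^ ((1 : ℝ) / 3)) (by positivity)
  have hsum4 := sum_theta_roots_le ht
  linarith

/-- Piece `g₁` (`1 ≤ t ≤ 4.2·10⁹ < 2³²`, KERNEL): `ψ − θ ≤ 1.021√t + (4/3)t^{1/3}`. -/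
theorem psi_sub_theta_le_g1 {t : ℝ} (ht : 1 ≤ t) (htA : t ≤ 4.2e9) :
    ψ t - θ t ≤ 1.021 * Real.sqrt t + 4 / 3 * t ^ ((1 : ℝ) / 3) := by
  have h := psi_sub_theta_le_of_lt_two_pow_32 ht (lt_of_le_of_lt htA (by norm_num))
  have hs := Real.sqrt_nonneg t
  linarith

/-- Piece `g₂` (`1 ≤ t ≤ 7.8·10¹³`, print-free): `ψ − θ ≤ 1.021√t + (4/3 + 0.51)t^{1/3}`. -/
theorem psi_sub_theta_le_g2 {t : ℝ} (ht : 1 ≤ t) (ht' : t ≤ 7.8e13) :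
    ψ t - θ t ≤ 1.021 * Real.sqrt t + (4 / 3 + 0.51) * t ^ ((1 : ℝ) / 3) := by
  have hs := Real.sqrt_nonneg t
  have h3 : 0 ≤ t ^ ((1 : ℝ) / 3) := Real.rpow_nonneg (by linarith) _
  rcases lt_or_ge t ((2 : ℝ) ^ 32) with h32 | h32
  · have h := psi_sub_theta_le_of_lt_two_pow_32 ht h32
    linarith
  · have h := psi_sub_theta_le_mid h32 ht'
    linarith

/-- Piece `g₃` (every `t ≥ 1`, print-free): `ψ − θ ≤ (1.021 + 0.3663)√t + (4/3 + 0.51)t^{1/3}`. -/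
theorem psi_sub_theta_le_g3 {t : ℝ} (ht : 1 ≤ t) :
    ψ t - θ t ≤ (1.021 + 0.3663) * Real.sqrt t + (4 / 3 + 0.51) * t ^ ((1 : ℝ) / 3) := by
  have hs := Real.sqrt_nonneg t
  have h3 : 0 ≤ t ^ ((1 : ℝ) / 3) := Real.rpow_nonneg (by linarith) _
  rcases lt_or_ge t ((2 : ℝ) ^ 32) with h32 | h32
  · have h := psi_sub_theta_le_of_lt_two_pow_32 ht h32
    linarith
  · have h := psi_sub_theta_le_far h32
    linarith

/-! ### F2 · the two weight constants and Nicolas's `J − K` with the KERNEL truncation -/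

/-- `F_{1/3}(4.2·10⁹) ≤ 3/(2·(4.2·10⁹)^{2/3}·log(4.2·10⁹)) ≤ 3/(2·2.6·10⁶·22) ≤ 2.63·10⁻⁸`. -/
theorem Fz_third_A_le : (Fz (1 / 3 : ℝ) 4.2e9).re ≤ 2.63e-8 := by
  refine (NicolasFz.Fthird_le (x := 4.2e9) (by norm_num)).trans ?_
  have hlog : (22 : ℝ) ≤ Real.log 4.2e9 := by
    rw [Real.le_log_iff_exp_le (by norm_num)]
    have e : Real.exp 22 = Real.exp 1 ^ 22 := by rw [← Real.exp_nat_mul]; norm_num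
    rw [e]
    exact (pow_le_pow_left₀ (Real.exp_pos 1).le Real.exp_one_lt_d9.le 22).trans (by norm_num)
  have hpow : (2.6e6 : ℝ) ≤ (4.2e9 : ℝ) ^ (2 / 3 : ℝ) := by
    rw [show (2 / 3 : ℝ) = ((2 : ℕ) : ℝ) * ((1 : ℝ) / 3) by norm_num, Real.rpow_mul (by norm_num), Real.rpow_natCast]
    have e2 : (2.6e6 : ℝ) = ((2.6e6 : ℝ) ^ (3 : ℕ)) ^ ((1 : ℝ) / 3) := by
      rw [← Real.rpow_natCast, ← Real.rpow_mul (by norm_num)]; norm_num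
    rw [e2]
    exact Real.rpow_le_rpow (by norm_num) (by norm_num) (by norm_num)
  have hden : (2 : ℝ) * 2.6e6 * 22 ≤ 2 * (4.2e9 : ℝ) ^ (2 / 3 : ℝ) * Real.log 4.2e9 :=
    mul_le_mul (mul_le_mul_of_nonneg_left hpow (by norm_num)) hlog (by norm_num) (by positivity)
  calc 3 / (2 * (4.2e9 : ℝ) ^ (2 / 3 : ℝ) * Real.log 4.2e9) ≤ 3 / (2 * 2.6e6 * 22) :=
        div_le_div_of_nonneg_left (by norm_num) (by norm_num) hden
    _ ≤ 2.63e-8 := by norm_num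

/-- `F_{1/2}(7.8·10¹³) ≤ 2/(√X₂·log X₂) ≤ 2/(8.83·10⁶·31) ≤ 7.4·10⁻⁹` (Nicolas 2012 (2.4): the `−2/log² + 8/log³` terms are `≤ 0`). -/
theorem Fz_half_X2_le : (Fz (1 / 2 : ℝ) 7.8e13).re ≤ 7.4e-9 := by
  refine (NicolasFz.Fhalf_le (x := 7.8e13) (by norm_num)).trans ?_
  have hL31 : (31 : ℝ) ≤ Real.log 7.8e13 := by
    rw [Real.le_log_iff_exp_le (by norm_num)]
    have e : Real.exp 31 = Real.exp 1 ^ 31 := by rw [← Real.exp_nat_mul]; norm_num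
    rw [e]
    exact (pow_le_pow_left₀ (Real.exp_pos 1).le Real.exp_one_lt_d9.le 31).trans (by norm_num)
  have hs883 : (8.83e6 : ℝ) ≤ √(7.8e13 : ℝ) := (Real.le_sqrt' (by norm_num)).2 (by norm_num)
  set L := Real.log 7.8e13 with hL
  set s := √(7.8e13 : ℝ) with hs
  have hs0 : 0 < s := lt_of_lt_of_le (by norm_num) hs883
  have hL0 : 0 < L := lt_of_lt_of_le (by norm_num) hL31
  have hsL2 : 0 < s * L ^ 2 := by positivity
  have hneg : 8 / (s * L ^ 3) ≤ 2 / (s * L ^ 2) := by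
    rw [div_le_div_iff₀ (by positivity) (by positivity)]
    nlinarith [mul_le_mul_of_nonneg_left hL31 hsL2.le]
  have hmain : 2 / (s * L) ≤ 7.4e-9 := by
    rw [div_le_iff₀ (by positivity)]
    nlinarith [mul_le_mul hs883 hL31 (by norm_num) hs0.le]
  linarith

/-- **F2 · Nicolas's Cor. 2.1 upper WITH THE KERNEL TRUNCATION** (print-free; tree `jk_partial_le` needs `ψ − θ ≤ 1.021√t + (4/3)t^{1/3}`
on all of `[x, ∞)`): for `599 ≤ x ≤ 8 886 113` and `X ≥ x`,
`∫_x^X (ψ − t)w₀ − ∫_x^X (θ − t)w₀ ≤ 1.021·F_{1/2}(x) + (4/3)·F_{1/3}(x) + 1.62·10⁻⁸`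
(split at `4.2·10⁹` and `7.8·10¹³`; pieces `g₁, g₂, g₃`; excess `0.51·F_{1/3}(4.2·10⁹) + 0.3663·F_{1/2}(7.8·10¹³)`). -/
theorem jk_partial_le_kernel {x X : ℝ} (hx : 599 ≤ x) (hx' : x ≤ 8886113) (hX : x ≤ X) :
    (∫ t in x..X, (ψ t - t) * w0 t) - ∫ t in x..X, (θ t - t) * w0 t ≤
      1.021 * (Fz (1 / 2 : ℝ) x).re + 4 / 3 * (Fz (1 / 3 : ℝ) x).re + 1.62e-8 := by
  have hx1 : 1 < x := by linarith
  set p₁ : ℝ := min X 4.2e9 with hp₁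
  set p₂ : ℝ := min X 7.8e13 with hp₂
  have hxp₁ : x ≤ p₁ := le_min hX (by linarith)
  have hp₁p₂ : p₁ ≤ p₂ := le_min (min_le_left _ _) ((min_le_right _ _).trans (by norm_num))
  have hp₂X : p₂ ≤ X := min_le_left _ _
  have hxp₂ : x ≤ p₂ := hxp₁.trans hp₁p₂
  have hp₁1 : 1 < p₁ := lt_of_lt_of_le hx1 hxp₁
  have hp₂1 : 1 < p₂ := lt_of_lt_of_le hx1 hxp₂
  have hp₁A : p₁ ≤ 4.2e9 := min_le_right _ _
  have hp₂B : p₂ ≤ 7.8e13 := min_le_right _ _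
  -- the integrand `(ψ − θ)·w₀`
  have hf : ∀ a b : ℝ, 1 < a → a ≤ b → IntervalIntegrable (fun t ↦ (ψ t - θ t) * w0 t) volume a b := by
    intro a b ha hab
    exact ((intervalIntegrable_R_mul_w0 ha hab).sub (intervalIntegrable_S_mul_w0 ha hab)).congr fun t _ ↦ by ring
  have hg : ∀ a b c₂ c₃ : ℝ, 1 < a → a ≤ b →
      IntervalIntegrable (fun t ↦ c₂ * (t ^ (1 / 2 : ℝ) * w0 t) + c₃ * (t ^ ((1 : ℝ) / 3) * w0 t)) volume a b := by
    intro a b c₂ c₃ ha hab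
    exact ((intervalIntegrable_rpow_mul_w0 (1 / 2) ha hab).const_mul c₂).add
      ((intervalIntegrable_rpow_mul_w0 ((1 : ℝ) / 3) ha hab).const_mul c₃)
  have hev : ∀ a b c₂ c₃ : ℝ, 1 < a → a ≤ b →
      ∫ t in a..b, (c₂ * (t ^ (1 / 2 : ℝ) * w0 t) + c₃ * (t ^ ((1 : ℝ) / 3) * w0 t)) =
        c₂ * (∫ t in a..b, t ^ (1 / 2 : ℝ) * w0 t) + c₃ * ∫ t in a..b, t ^ ((1 : ℝ) / 3) * w0 t := by
    intro a b c₂ c₃ ha hab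
    rw [intervalIntegral.integral_add ((intervalIntegrable_rpow_mul_w0 (1 / 2) ha hab).const_mul c₂)
        ((intervalIntegrable_rpow_mul_w0 ((1 : ℝ) / 3) ha hab).const_mul c₃),
      intervalIntegral.integral_const_mul, intervalIntegral.integral_const_mul]
  -- pointwise domination on a piece
  have hdom : ∀ {a b c₂ c₃ : ℝ}, 1 < a → a ≤ b →
      (∀ t : ℝ, a ≤ t → t ≤ b → ψ t - θ t ≤ c₂ * Real.sqrt t + c₃ * t ^ ((1 : ℝ) / 3)) →
      ∫ t in a..b, (ψ t - θ t) * w0 t ≤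
        c₂ * (∫ t in a..b, t ^ (1 / 2 : ℝ) * w0 t) + c₃ * ∫ t in a..b, t ^ ((1 : ℝ) / 3) * w0 t := by
    intro a b c₂ c₃ ha hab hpt
    rw [← hev a b c₂ c₃ ha hab]
    refine intervalIntegral.integral_mono_on hab (hf a b ha hab) (hg a b c₂ c₃ ha hab) fun t ht ↦ ?_
    have ht1 : 1 < t := ha.trans_le ht.1
    have h := hpt t ht.1 ht.2
    rw [Real.sqrt_eq_rpow] at h
    have hw := (w0_pos ht1).le
    calc (ψ t - θ t) * w0 t ≤ (c₂ * t ^ (1 / 2 : ℝ) + c₃ * t ^ ((1 : ℝ) / 3)) * w0 t :=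
          mul_le_mul_of_nonneg_right h hw
      _ = _ := by ring
  -- J − K as one integral, split at p₁ and p₂
  have hiψ := intervalIntegrable_R_mul_w0 hx1 hX
  have hiθ := intervalIntegrable_S_mul_w0 hx1 hX
  rw [← intervalIntegral.integral_sub hiψ hiθ]
  have hsimp : ∫ t in x..X, ((ψ t - t) * w0 t - (θ t - t) * w0 t) = ∫ t in x..X, (ψ t - θ t) * w0 t :=
    intervalIntegral.integral_congr fun t _ ↦ by ring
  rw [hsimp]
  have hsplit : ∫ t in x..X, (ψ t - θ t) * w0 t =
      (∫ t in x..p₁, (ψ t - θ t) * w0 t) + (∫ t in p₁..p₂, (ψ t - θ t) * w0 t) +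
        ∫ t in p₂..X, (ψ t - θ t) * w0 t := by
    rw [intervalIntegral.integral_add_adjacent_intervals (hf x p₁ hx1 hxp₁) (hf p₁ p₂ hp₁1 hp₁p₂),
      intervalIntegral.integral_add_adjacent_intervals (hf x p₂ hx1 hxp₂) (hf p₂ X hp₂1 hp₂X)]
  -- the three pieces
  have hI₁ := hdom hx1 hxp₁ (c₂ := 1.021) (c₃ := 4 / 3)
    fun t ht htb ↦ psi_sub_theta_le_g1 (hx1.le.trans ht) (htb.trans hp₁A)
  have hI₂ := hdom hp₁1 hp₁p₂ (c₂ := 1.021) (c₃ := 4 / 3 + 0.51)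
    fun t ht htb ↦ psi_sub_theta_le_g2 (hp₁1.le.trans ht) (htb.trans hp₂B)
  have hI₃ := hdom hp₂1 hp₂X (c₂ := 1.021 + 0.3663) (c₃ := 4 / 3 + 0.51)
    fun t ht _ ↦ psi_sub_theta_le_g3 (hp₂1.le.trans ht)
  -- the basic integrals recombined
  have hS : (∫ t in x..p₁, t ^ (1 / 2 : ℝ) * w0 t) + (∫ t in p₁..p₂, t ^ (1 / 2 : ℝ) * w0 t) +
      (∫ t in p₂..X, t ^ (1 / 2 : ℝ) * w0 t) ≤ (Fz (1 / 2 : ℝ) x).re := by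
    rw [intervalIntegral.integral_add_adjacent_intervals (intervalIntegrable_rpow_mul_w0 _ hx1 hxp₁)
        (intervalIntegrable_rpow_mul_w0 _ hp₁1 hp₁p₂),
      intervalIntegral.integral_add_adjacent_intervals (intervalIntegrable_rpow_mul_w0 _ hx1 hxp₂)
        (intervalIntegrable_rpow_mul_w0 _ hp₂1 hp₂X)]
    exact integral_rpow_mul_w0_le_Fz (a := 1 / 2) (by norm_num) hx1 hX
  have hC : (∫ t in x..p₁, t ^ ((1 : ℝ) / 3) * w0 t) + (∫ t in p₁..p₂, t ^ ((1 : ℝ) / 3) * w0 t) +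
      (∫ t in p₂..X, t ^ ((1 : ℝ) / 3) * w0 t) ≤ (Fz (1 / 3 : ℝ) x).re := by
    rw [intervalIntegral.integral_add_adjacent_intervals (intervalIntegrable_rpow_mul_w0 _ hx1 hxp₁)
        (intervalIntegrable_rpow_mul_w0 _ hp₁1 hp₁p₂),
      intervalIntegral.integral_add_adjacent_intervals (intervalIntegrable_rpow_mul_w0 _ hx1 hxp₂)
        (intervalIntegrable_rpow_mul_w0 _ hp₂1 hp₂X)]
    have h := integral_rpow_mul_w0_le_Fz (a := (1 : ℝ) / 3) (by norm_num) hx1 hX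
    rw [show ((1 : ℝ) / 3) = (1 / 3 : ℝ) by norm_num] at h ⊢
    exact h
  -- the two truncation constants
  have hC23 : (∫ t in p₁..p₂, t ^ ((1 : ℝ) / 3) * w0 t) + (∫ t in p₂..X, t ^ ((1 : ℝ) / 3) * w0 t) ≤ 2.63e-8 := by
    rw [intervalIntegral.integral_add_adjacent_intervals (intervalIntegrable_rpow_mul_w0 _ hp₁1 hp₁p₂)
        (intervalIntegrable_rpow_mul_w0 _ hp₂1 hp₂X)]
    rcases le_total X 4.2e9 with hXA | hAX
    · have e : p₁ = X := min_eq_left hXA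
      rw [e, intervalIntegral.integral_same]
      norm_num
    · have e : p₁ = 4.2e9 := min_eq_right hAX
      rw [e]
      have h := integral_rpow_mul_w0_le_Fz (a := (1 : ℝ) / 3) (by norm_num) (by norm_num : (1 : ℝ) < 4.2e9) hAX
      rw [show ((1 : ℝ) / 3) = (1 / 3 : ℝ) by norm_num] at h ⊢
      exact h.trans Fz_third_A_le
  have hS3 : (∫ t in p₂..X, t ^ (1 / 2 : ℝ) * w0 t) ≤ 7.4e-9 := by
    rcases le_total X 7.8e13 with hXB | hBX
    · have e : p₂ = X := min_eq_left hXB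
      rw [e, intervalIntegral.integral_same]
      norm_num
    · have e : p₂ = 7.8e13 := min_eq_right hBX
      rw [e]
      exact (integral_rpow_mul_w0_le_Fz (a := 1 / 2) (by norm_num) (by norm_num : (1 : ℝ) < 7.8e13) hBX).trans
        Fz_half_X2_le
  -- nonnegativity of the first pieces (for the bookkeeping)
  have hS1 : 0 ≤ ∫ t in x..p₁, t ^ (1 / 2 : ℝ) * w0 t :=
    intervalIntegral.integral_nonneg hxp₁ fun t ht ↦
      mul_nonneg (Real.rpow_nonneg (by linarith [ht.1]) _) (w0_pos (hx1.trans_le ht.1)).le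
  have hS2 : 0 ≤ ∫ t in p₁..p₂, t ^ (1 / 2 : ℝ) * w0 t :=
    intervalIntegral.integral_nonneg hp₁p₂ fun t ht ↦
      mul_nonneg (Real.rpow_nonneg (by linarith [ht.1]) _) (w0_pos (hp₁1.trans_le ht.1)).le
  have hC1 : 0 ≤ ∫ t in x..p₁, t ^ ((1 : ℝ) / 3) * w0 t :=
    intervalIntegral.integral_nonneg hxp₁ fun t ht ↦
      mul_nonneg (Real.rpow_nonneg (by linarith [ht.1]) _) (w0_pos (hx1.trans_le ht.1)).le
  rw [hsplit]
  nlinarith [hI₁, hI₂, hI₃, hS, hC, hC23, hS3, hS1, hS2, hC1]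

/-- `log 8886113 ≤ 16.001` (`e¹⁶·e^{0.001} ≥ 2.7182818283¹⁶·1.001 ≥ 8 894 000`). -/
theorem log_8886113_le : Real.log 8886113 ≤ 16.001 := by
  rw [Real.log_le_iff_le_exp (by norm_num)]
  have h1 : Real.exp 16.001 = Real.exp 1 ^ 16 * Real.exp 0.001 := by
    rw [← Real.exp_nat_mul, ← Real.exp_add]; norm_num
  have h2 : (2.7182818283 : ℝ) ^ 16 ≤ Real.exp 1 ^ 16 := pow_le_pow_left₀ (by norm_num) Real.exp_one_gt_d9.le 16
  have h3 : (1.001 : ℝ) ≤ Real.exp 0.001 := by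
    have := Real.add_one_le_exp (0.001 : ℝ); linarith
  have h4 : (8886113 : ℝ) ≤ 2.7182818283 ^ 16 * 1.001 := by norm_num
  calc (8886113 : ℝ) ≤ 2.7182818283 ^ 16 * 1.001 := h4
    _ ≤ Real.exp 1 ^ 16 * Real.exp 0.001 := mul_le_mul h2 h3 (by norm_num) (by positivity)
    _ = Real.exp 16.001 := h1.symm

end KernelPsiTheta

end Summit.RiemannHypothesis.RiemannHypothesis.Theorems.Splittings.RobinFiniteC1

end
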